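import Mathlib
import HarnessLib
import Summits.HubbardSuperconductivity.HubbardSuperconductivity.Theorems.KLProgrammeKLRegimeEngineKernelNormsWt4

/-!
# Route `KLProgramme` — crux K3 ENGINE (stmt-HubbardSuperconductivity-20437 `KLRegimeEngineV17F2`), stub (b): the blocked-tower bookkeeping,
# part 14 — RATE COMPARISON for the weighted lines: the reduced-rate device of the E1 word on token #19 (evidence #48 `E1-WORD10-g8`, (W2))
# (E1 lead r2d-p2 g8)

The registered weighted line of conjunct 2 reads `klWtPinnedSum … (K_n) j`, whose weight is the level-`j` tree weight `klScaleWt L M β j S = 1 + Λ_j·diam(S)`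
(rate `Λ_j = klScale klE0 j`).  At the internal boundaries `J < j*(n)` of the one-shot tower at the frame `K_n` the slice covariances' weighted row/column sums
at rate `Λ_J` carry the (c-D) frame-roughness excess `X_J(n)` (k3c3-p2 CD-LIMITS §1–§3); fed into the MULTIPLICATIVE weighted Grassmann steps that excess would
multiply the convergence ratio.  The tower therefore runs its weighted bookkeeping at boundary `J` at a REDUCED RATE `r ≤ Λ_J` with `Λ_J ≤ c·r`
(`c = 1 + X_J(n)`), where the slice moment part is `O(1)`, and converts at the output.  This file is the (elementary) conversion:

* §1 the rate-`r` diameter weight `S ↦ 1 + r·diam(S)` on the `4M`-grid label sets, written `diamWeight (fun s => 1 + r * s) (gridLabelDist L (4M) β)` (no definition;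
  `klScaleWt L M β j` is the rate `Λ_j` by `rfl`, `klScaleWt_eq_rateWt`), `isTreeWeight_rateWt` (every rate `r ≥ 0` gives a tree weight, so the weighted Grassmann suppliers apply verbatim at the reduced rate),
  `rateWt_mono_rate` (monotone in the rate), **`rateWt_le_mul_rateWt`** (`Λ ≤ c·r`, `1 ≤ c` ⇒ `1 + Λ·diam ≤ c·(1 + r·diam)`), `klScaleWt_le_mul_rateWt`,
  `rateWt_le_klScaleWt` (`r ≤ Λ_j`);
* §2 the weighted pinned sums at two rates: `ratePinnedSum_le_of_rate_le` (monotone in the rate) and **`klScalePinnedSum_le_mul_ratePinnedSum`** — the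
  `klScaleWt_j`-weighted pinned sum of ANY Grassmann element is at most `c` times its `r`-weighted pinned sum whenever `Λ_j ≤ c·r`;
* §3 **`kernelNormsWt4_of_ratePinnedSum`** — if the reduced-rate profile of the scale-`j` action at the frame `K` is within a budget `N` (degrees `m ≠ 2`), then
  `KernelNormsWt4 L M (fun m => c · N m) β U μ K j`: the registered `Λ_j`-line with the allowance factor `c = 1 + X_J(n)` to the power ONE (token #19's shape,
  exponent 1), and `kernelNormsWt4_of_ratePinnedSum_of_le` (any budget `N' ≥ c·N`).

Pure bookkeeping on weights; nothing about the model is asserted; nothing asserts superconductivity.  NOT here: the value of `X_J(n)` (CD-LIMITS) or any slice estimate.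
References: BGM 2006 §3 (3.2)–(3.8) (decay weights ride the tree expansion at no cost in the exponents) [cite: BenfattoGiulianiMastropietro2006].
-/

noncomputable section

namespace Summit.HubbardSuperconductivity.HubbardSuperconductivity.Theorems.EngineV8

set_option linter.dupNamespace false -- summit = problem name (single-conjunct summit), D-0017

open Real Finset Literature.MathematicalPhysics.QuantumLattice Literature.Probability.LatticeModels GrassmannAlgebra
open Literature.Probability.LatticeModels.BattleFederbush
open Summit.HubbardSuperconductivity.HubbardSuperconductivity.Theorems.KLProgrammeLegKernels
open Summit.HubbardSuperconductivity.HubbardSuperconductivity.Theorems.KLRegimeSplit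

/-! ## §1 The diameter weight at an arbitrary rate -/

/-- Unfolding the rate-`r` diameter weight `S ↦ 1 + r · diam_d(S)` (`d = gridLabelDist L (4M) β`; written through the tree's `diamWeight`, no new notion —
`klScaleWt L M β j` is the rate `Λ_j = klScale klE0 j`, the reduced-rate tower uses `r = Λ_J/(1 + X_J(n))`). -/
theorem rateWt_apply (L M : ℕ) (β r : ℝ) (S : Finset (ZMod (2 * (2 * M)) × TorusSite 2 L)) :
    diamWeight (fun s => 1 + r * s) (gridLabelDist L (2 * (2 * M)) β) S = 1 + r * labelDiam (gridLabelDist L (2 * (2 * M)) β) S := rfl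

/-- `klScaleWt L M β j` IS the rate-`Λ_j` weight. -/
theorem klScaleWt_eq_rateWt (L M : ℕ) (β : ℝ) (j : ℕ) (S : Finset (ZMod (2 * (2 * M)) × TorusSite 2 L)) :
    klScaleWt L M β j S = diamWeight (fun s => 1 + klScale klE0 j * s) (gridLabelDist L (2 * (2 * M)) β) S := rfl

/-- **Every nonnegative rate gives a tree weight** (`β ≥ 0`): `s ↦ 1 + r s` is `≥ 1`, monotone and submultiplicative on `[0, ∞)` — so the weighted Grassmann suppliers
(`GrassmannWeighted…`, `IsTreeWeight wt`) apply verbatim at the reduced rate. -/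
theorem isTreeWeight_rateWt (L M : ℕ) [NeZero L] [NeZero M] {β : ℝ} (hβ : 0 ≤ β) {r : ℝ} (hr : 0 ≤ r) : IsTreeWeight (diamWeight (fun s => 1 + r * s) (gridLabelDist L (2 * (2 * M)) β)) := by
  haveI : NeZero (2 * (2 * M)) := ⟨by have := NeZero.ne M; omega⟩
  refine isTreeWeight_diamWeight (isLabelDist_gridLabelDist L (2 * (2 * M)) hβ) (fun s hs => ?_) (fun s t hs hst => ?_) (fun s t hs ht => ?_)
  · have := mul_nonneg hr hs; linarith
  · have := mul_le_mul_of_nonneg_left hst hr; linarith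
  · have h1 := mul_nonneg hr hs
    have h2 := mul_nonneg hr ht
    nlinarith [mul_nonneg h1 h2]

/-- `1 ≤ rateWt` for `r ≥ 0`. -/
theorem one_le_rateWt (L M : ℕ) (β : ℝ) {r : ℝ} (hr : 0 ≤ r) (S : Finset (ZMod (2 * (2 * M)) × TorusSite 2 L)) :
    1 ≤ diamWeight (fun s => 1 + r * s) (gridLabelDist L (2 * (2 * M)) β) S := by
  rw [rateWt_apply]
  have := mul_nonneg hr (labelDiam_nonneg (gridLabelDist L (2 * (2 * M)) β) S)
  linarith

/-- **Monotone in the rate**: `r ≤ r'` ⇒ `rateWt … r S ≤ rateWt … r' S`. -/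
theorem rateWt_mono_rate (L M : ℕ) (β : ℝ) {r r' : ℝ} (h : r ≤ r') (S : Finset (ZMod (2 * (2 * M)) × TorusSite 2 L)) :
    diamWeight (fun s => 1 + r * s) (gridLabelDist L (2 * (2 * M)) β) S ≤ diamWeight (fun s => 1 + r' * s) (gridLabelDist L (2 * (2 * M)) β) S := by
  rw [rateWt_apply, rateWt_apply]
  have := mul_le_mul_of_nonneg_right h (labelDiam_nonneg (gridLabelDist L (2 * (2 * M)) β) S)
  linarith

/-- **THE CONVERSION**: `Λ ≤ c·r` with `1 ≤ c` ⇒ `1 + Λ·diam ≤ c·(1 + r·diam)`, i.e. `rateWt … Λ S ≤ c · rateWt … r S`. -/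
theorem rateWt_le_mul_rateWt (L M : ℕ) (β : ℝ) {Λ r c : ℝ} (hc : 1 ≤ c) (hΛ : Λ ≤ c * r) (S : Finset (ZMod (2 * (2 * M)) × TorusSite 2 L)) :
    diamWeight (fun s => 1 + Λ * s) (gridLabelDist L (2 * (2 * M)) β) S ≤ c * diamWeight (fun s => 1 + r * s) (gridLabelDist L (2 * (2 * M)) β) S := by
  rw [rateWt_apply, rateWt_apply]
  have hd := labelDiam_nonneg (gridLabelDist L (2 * (2 * M)) β) S
  have h1 := mul_le_mul_of_nonneg_right hΛ hd
  nlinarith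

/-- The level-`j` weight against a reduced rate: `Λ_j ≤ c·r`, `1 ≤ c` ⇒ `klScaleWt L M β j S ≤ c · rateWt L M β r S`. -/
theorem klScaleWt_le_mul_rateWt (L M : ℕ) (β : ℝ) (j : ℕ) {r c : ℝ} (hc : 1 ≤ c) (hΛ : klScale klE0 j ≤ c * r)
    (S : Finset (ZMod (2 * (2 * M)) × TorusSite 2 L)) :
    klScaleWt L M β j S ≤ c * diamWeight (fun s => 1 + r * s) (gridLabelDist L (2 * (2 * M)) β) S := by
  rw [klScaleWt_eq_rateWt]; exact rateWt_le_mul_rateWt L M β hc hΛ S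

/-- A reduced rate never weighs more than the level-`j` weight: `r ≤ Λ_j` ⇒ `rateWt … r S ≤ klScaleWt L M β j S`. -/
theorem rateWt_le_klScaleWt (L M : ℕ) (β : ℝ) (j : ℕ) {r : ℝ} (hr : r ≤ klScale klE0 j) (S : Finset (ZMod (2 * (2 * M)) × TorusSite 2 L)) :
    diamWeight (fun s => 1 + r * s) (gridLabelDist L (2 * (2 * M)) β) S ≤ klScaleWt L M β j S := by
  rw [klScaleWt_eq_rateWt]; exact rateWt_mono_rate L M β hr S

/-! ## §2 The weighted pinned sums at two rates -/

section Pinned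

variable {L M : ℕ} [NeZero L]

/-- **Monotone in the rate**: the rate-`r` weighted pinned sum of any Grassmann element `T` (family of level `j` at the frame `K`, degree `m`, leg `q` pinned at `w`)
is at most the rate-`r'` one for `r ≤ r'` (`β ≥ 0`). -/
theorem ratePinnedSum_le_of_rate_le {β : ℝ} (hβ : 0 ≤ β) (μ : ℝ) (K : TrigPolyC4v) (j m : ℕ) {r r' : ℝ} (h : r ≤ r') (T : HubbardGrassmann L M)
    (q : Fin m) (w : SpaceTimeIdx L M × SectorLeg (sectorCount j)) :
    imagTimeWeight β M ^ (m - 1) *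
        ∑ X ∈ univ.filter (fun X : Fin m → SpaceTimeIdx L M × SectorLeg (sectorCount j) => X q = w),
          diamWeight (fun s => 1 + r * s) (gridLabelDist L (2 * (2 * M)) β) ((univ.image X).image (latticeLegPos (2 * (2 * M)))) *
            ‖kernel ℂ (ExteriorAlgebra.map (Matrix.toLin' (sectorAnalysisMatrix L M β (klAnisoFamily L M β μ K klE0 j))) T) m X‖ ≤
      imagTimeWeight β M ^ (m - 1) *
        ∑ X ∈ univ.filter (fun X : Fin m → SpaceTimeIdx L M × SectorLeg (sectorCount j) => X q = w),
          diamWeight (fun s => 1 + r' * s) (gridLabelDist L (2 * (2 * M)) β) ((univ.image X).image (latticeLegPos (2 * (2 * M)))) *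
            ‖kernel ℂ (ExteriorAlgebra.map (Matrix.toLin' (sectorAnalysisMatrix L M β (klAnisoFamily L M β μ K klE0 j))) T) m X‖ :=
  mul_le_mul_of_nonneg_left (sum_le_sum fun _ _ => mul_le_mul_of_nonneg_right (rateWt_mono_rate L M β h _) (norm_nonneg _))
    (pow_nonneg (imagTimeWeight_nonneg hβ M) _)

/-- **THE CONVERSION AT THE OUTPUT**: for `Λ_j ≤ c·r` (`1 ≤ c`, `β ≥ 0`) the `klScaleWt_j`-weighted pinned sum of any Grassmann element `T` is at most `c` times
its rate-`r` weighted pinned sum. -/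
theorem klScalePinnedSum_le_mul_ratePinnedSum {β : ℝ} (hβ : 0 ≤ β) (μ : ℝ) (K : TrigPolyC4v) (j m : ℕ) {r c : ℝ} (hc : 1 ≤ c)
    (hΛ : klScale klE0 j ≤ c * r) (T : HubbardGrassmann L M) (q : Fin m) (w : SpaceTimeIdx L M × SectorLeg (sectorCount j)) :
    imagTimeWeight β M ^ (m - 1) *
        ∑ X ∈ univ.filter (fun X : Fin m → SpaceTimeIdx L M × SectorLeg (sectorCount j) => X q = w),
          klScaleWt L M β j ((univ.image X).image (latticeLegPos (2 * (2 * M)))) *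
            ‖kernel ℂ (ExteriorAlgebra.map (Matrix.toLin' (sectorAnalysisMatrix L M β (klAnisoFamily L M β μ K klE0 j))) T) m X‖ ≤
      c * (imagTimeWeight β M ^ (m - 1) *
        ∑ X ∈ univ.filter (fun X : Fin m → SpaceTimeIdx L M × SectorLeg (sectorCount j) => X q = w),
          diamWeight (fun s => 1 + r * s) (gridLabelDist L (2 * (2 * M)) β) ((univ.image X).image (latticeLegPos (2 * (2 * M)))) *
            ‖kernel ℂ (ExteriorAlgebra.map (Matrix.toLin' (sectorAnalysisMatrix L M β (klAnisoFamily L M β μ K klE0 j))) T) m X‖) := by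
  conv_rhs => rw [mul_left_comm]
  refine mul_le_mul_of_nonneg_left ?_ (pow_nonneg (imagTimeWeight_nonneg hβ M) _)
  rw [mul_sum]
  refine sum_le_sum fun X _ => ?_
  exact (mul_le_mul_of_nonneg_right (klScaleWt_le_mul_rateWt L M β j hc hΛ _) (norm_nonneg _)).trans_eq (mul_assoc _ _ _)

/-! ## §3 `KernelNormsWt4` from a reduced-rate profile, with the allowance factor to the power one -/

/-- **The registered `Λ_j`-line from a REDUCED-RATE profile, allowance `c` to the power ONE**: if the rate-`r` weighted pinned sums of the scale-`j` action at the
frame `K` are `≤ N m` in every degree `m ≠ 2` (all pins) and `Λ_j ≤ c·r` (`1 ≤ c`), then `KernelNormsWt4 L M (fun m => c * N m) β U μ K j`. -/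
theorem kernelNormsWt4_of_ratePinnedSum {β : ℝ} (hβ : 0 ≤ β) {U μ : ℝ} {K : TrigPolyC4v} {j : ℕ} {r c : ℝ} (hc : 1 ≤ c)
    (hΛ : klScale klE0 j ≤ c * r) {N : ℕ → ℝ}
    (hN : ∀ m : ℕ, m ≠ 2 → ∀ (q : Fin m) (w : SpaceTimeIdx L M × SectorLeg (sectorCount j)),
      imagTimeWeight β M ^ (m - 1) *
        ∑ X ∈ univ.filter (fun X : Fin m → SpaceTimeIdx L M × SectorLeg (sectorCount j) => X q = w),
          diamWeight (fun s => 1 + r * s) (gridLabelDist L (2 * (2 * M)) β) ((univ.image X).image (latticeLegPos (2 * (2 * M)))) *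
            ‖kernel ℂ (ExteriorAlgebra.map (Matrix.toLin' (sectorAnalysisMatrix L M β (klAnisoFamily L M β μ K klE0 j)))
                (klEffectiveAction L M β U μ K klE0 j)) m X‖ ≤ N m) :
    KernelNormsWt4 L M (fun m => c * N m) β U μ K j := by
  intro m hm q w
  rw [klWtPinnedSum_def]
  exact (klScalePinnedSum_le_mul_ratePinnedSum hβ μ K j m hc hΛ _ q w).trans
    (mul_le_mul_of_nonneg_left (hN m hm q w) (zero_le_one.trans hc))

/-- … and inside any budget `N'` with `c · N m ≤ N' m` (degrees `m ≠ 2`) — e.g. `N' = klWtBudgetF` of token #19 with `klWtAllow ≥ c`, or `N' = klWtBudget` once `c` is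
absorbed in `CE`. -/
theorem kernelNormsWt4_of_ratePinnedSum_of_le {β : ℝ} (hβ : 0 ≤ β) {U μ : ℝ} {K : TrigPolyC4v} {j : ℕ} {r c : ℝ} (hc : 1 ≤ c)
    (hΛ : klScale klE0 j ≤ c * r) {N N' : ℕ → ℝ}
    (hN : ∀ m : ℕ, m ≠ 2 → ∀ (q : Fin m) (w : SpaceTimeIdx L M × SectorLeg (sectorCount j)),
      imagTimeWeight β M ^ (m - 1) *
        ∑ X ∈ univ.filter (fun X : Fin m → SpaceTimeIdx L M × SectorLeg (sectorCount j) => X q = w),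
          diamWeight (fun s => 1 + r * s) (gridLabelDist L (2 * (2 * M)) β) ((univ.image X).image (latticeLegPos (2 * (2 * M)))) *
            ‖kernel ℂ (ExteriorAlgebra.map (Matrix.toLin' (sectorAnalysisMatrix L M β (klAnisoFamily L M β μ K klE0 j)))
                (klEffectiveAction L M β U μ K klE0 j)) m X‖ ≤ N m)
    (hNN' : ∀ m : ℕ, m ≠ 2 → c * N m ≤ N' m) : KernelNormsWt4 L M N' β U μ K j :=
  fun m hm q w => (kernelNormsWt4_of_ratePinnedSum hβ hc hΛ hN m hm q w).trans (hNN' m hm)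

/-- **The reduced rate of the E1 word**: with `r = Λ_j / c` (`1 ≤ c`) the hypothesis `Λ_j ≤ c·r` holds with equality and `0 ≤ r`. -/
theorem klScale_le_mul_div (j : ℕ) {c : ℝ} (hc : 1 ≤ c) : klScale klE0 j ≤ c * (klScale klE0 j / c) ∧ 0 ≤ klScale klE0 j / c := by
  have hc0 : 0 < c := zero_lt_one.trans_le hc
  exact ⟨(mul_div_cancel₀ _ hc0.ne').ge, div_nonneg (klth_klScale_pos j).le hc0.le⟩

end Pinned

end Summit.HubbardSuperconductivity.HubbardSuperconductivity.Theorems.EngineV8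

end
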